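import Summits.CriticalPhenomena.PercolationContinuityZ3.Theorems.Transplant.SkelPhiParaRunCoarse
import Summits.CriticalPhenomena.PercolationContinuityZ3.Theorems.Transplant.SkelPhiHabLevels
import HarnessLib

/-!
# N1 (the `{±1}` node), LEVEL 1, (C) column file (C-N4): THE FRAME CHANGE of the two-frame (C) corridor — reading a vertex's COARSE position
# (hp-8's `ρ = coarseSkel φ t₀ A n h vα vβ c s₀ s₁ D`, a `ρ`-box about a reference vertex `c₀`) BACK into p1-g11's RUN FRAME about `c₀`
# (`runX φ c₀ n h σ = (σ·Δα, ⌊σ·Δβ′/(n+|h|)⌋)`): inverting `ρ = ⌊(cλ + s)/D⌋` gives `|c·Δλ| ≤ D(|Δρ| + 1) − 1`, and the exact identities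
# `A·m·Δα = n·Δλ₀ + vα·Δλ₁`, `Δλ₁ = A·Δβ′` give `c·A·m·|Δα| ≤ D·(n(K₀+1) + |vα|(K₁+1))`, `c·A·|Δβ′| ≤ D·(K₁+1)` — the ADDITIVE blow-up
# `(|vα|/n)·(other extent)` of HOME/prim-bschramm-p5-g8/C-FUNNEL.md (F-box); then the habitat-window containment `WinIn ρ Ω (ρ-box) ⊆ WinIn (runX …) Ω (run-box)`
# = the cross link `hx` of `WinChainData.chain₂` (SkelPhiWinChainF2) between phase 1 (over ρ) and phase 2 (over runX)

builds on p205010 (kernel theorem, internal audit signed; external expert review pending) — nothing in this file uses p205010; nothing here is a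
claim about the open node `SamePDropOfSkeletonNeg`.
Lane `prim-bschramm`, seat `prim-bschramm-p5` (gen 8; (C) lineage; p3-g8 ruling 13:01Z: two-frame chain); helper file (`--supports stmt-CriticalPhenomena-4575`).
* §1 `abs_mul_sub_le_of_coarse` (`|ρ x − ρ y| ≤ K ⇒ |c x − c y| ≤ D(K+1) − 1`), `neg_ediv_sub_one_le`, `abs_ediv_le_of_abs_le` (`|x| ≤ B ⇒ |x/C| ≤ B/C + 1`);
* §2 `A_mul_modulus_mul_relCoord_eq` (`A·m·Δα = n·Δλ₀ + vα·Δλ₁`), **`run_bounds_of_coarse_bounds`** (`|Δρ₀| ≤ K₀`, `|Δρ₁| ≤ K₁` ⇒ the two scaled bounds),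
  **`relCoord_shearCoord_le_of_coarse`** (`|Δα| ≤ a`, `|Δβ′| ≤ B` under `D(n(K₀+1) + |vα|(K₁+1)) ≤ cAm·a`, `D(K₁+1) ≤ cA·B`),
  **`runX_mem_Icc_of_coarse`** (`runX φ c₀ n h σ v ∈ Icc (−(a, b)) (a, b)` with `B/(n+|h|) + 1 ≤ b`);
* §3 **`winIn_coarse_subset_winIn_runX`** (the cross link: the habitat window over the ρ-box `ρ(c₀) ± (K₀, K₁)` lies in the habitat window over the run box).
[cite: MartineauTassion2017, §4.1 (the lattice z₁u + z₂v)] [cite: KozmaNitzan2024, §4 Lemma 12 (pp. 23–25)]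
-/

noncomputable section

namespace Summit.CriticalPhenomena.PercolationContinuityZ3.Theorems.Transplant

namespace Skelφ

open Literature.Probability.Percolation Literature.Probability.LatticeModels SimpleGraph
open TwoAxis.Para (coarse lam0 lam1 modulus)

variable {V : Type} {G : SimpleGraph V} {φ : V → Site 2}

/-! ## §1 Inverting the coarse map -/

omit V G φ in
/-- **Inverting the coarse map**: `|ρ x − ρ y| ≤ K` for `ρ t = ⌊(c t + s)/D⌋` (`0 < D`) gives `|c x − c y| ≤ D (K + 1) − 1`. [folklore] -/
theorem abs_mul_sub_le_of_coarse {c s D x y K : ℤ} (hD : 0 < D) (h : |coarse c s D x - coarse c s D y| ≤ K) : |c * x - c * y| ≤ D * (K + 1) - 1 := by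
  unfold coarse at h
  have h1 := Int.mul_ediv_add_emod (c * x + s) D
  have h2 := Int.mul_ediv_add_emod (c * y + s) D
  have r1 := Int.emod_nonneg (c * x + s) hD.ne'; have r1' := Int.emod_lt_of_pos (c * x + s) hD
  have r2 := Int.emod_nonneg (c * y + s) hD.ne'; have r2' := Int.emod_lt_of_pos (c * y + s) hD
  rw [abs_le] at h ⊢
  set qx := (c * x + s) / D
  set qy := (c * y + s) / D
  constructor <;> nlinarith [h.1, h.2]

omit V G φ in
/-- `−(B/C) − 1 ≤ (−B)/C` for `0 < C` (floor of the negative vs the negative of the floor). [folklore] -/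
theorem neg_ediv_sub_one_le (B : ℤ) {C : ℤ} (hC : 0 < C) : -(B / C) - 1 ≤ (-B) / C := by
  have h1 := Int.mul_ediv_add_emod B C
  have h2 := Int.mul_ediv_add_emod (-B) C
  have r1 := Int.emod_nonneg B hC.ne'; have r1' := Int.emod_lt_of_pos B hC
  have r2 := Int.emod_nonneg (-B) hC.ne'; have r2' := Int.emod_lt_of_pos (-B) hC
  by_contra hc
  push Not at hc
  have : (-B) / C + 2 ≤ -(B / C) + 1 := by omega
  nlinarith

omit V G φ in
/-- `|x| ≤ B ⇒ |x / C| ≤ B / C + 1` (`0 < C`). [folklore] -/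
theorem abs_ediv_le_of_abs_le {x B C : ℤ} (hC : 0 < C) (h : |x| ≤ B) : |x / C| ≤ B / C + 1 := by
  rw [abs_le] at h ⊢
  have h1 : x / C ≤ B / C := Int.ediv_le_ediv hC h.2
  have h2 : (-B) / C ≤ x / C := Int.ediv_le_ediv hC h.1
  have h3 := neg_ediv_sub_one_le B hC
  constructor <;> omega

/-! ## §2 Run coordinates from coarse coordinates -/

/-- **`A·m·Δα = n·Δλ₀ + vα·Δλ₁`** (about the cell base `t₀`, origin `c₀`). [cite: MartineauTassion2017, §4.1] -/
theorem A_mul_modulus_mul_relCoord_eq (A : ℤ) (n : ℕ) (h vα vβ : ℤ) (t₀ c₀ g : V) :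
    A * modulus n h vα vβ * relCoord φ c₀ 0 g =
      (n : ℤ) * (lam0 A vα vβ (relφ φ t₀ g) - lam0 A vα vβ (relφ φ t₀ c₀)) + vα * (lam1 A n h (relφ φ t₀ g) - lam1 A n h (relφ φ t₀ c₀)) := by
  rw [mul_lam0_sub_origin, lam1_sub_origin]; ring

/-- **Scaled run bounds from coarse bounds**: `|Δρ₀| ≤ K₀`, `|Δρ₁| ≤ K₁` (about `c₀`) give `c·A·m·|Δα| ≤ D·(n(K₀+1) + |vα|(K₁+1))` and
`c·A·|Δβ′| ≤ D·(K₁+1)` (`0 ≤ c`, `0 ≤ A`, `0 ≤ m`, `0 < D`). [cite: MartineauTassion2017, §4.1] -/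
theorem run_bounds_of_coarse_bounds {A : ℤ} (hA : 0 ≤ A) {n : ℕ} {h vα vβ : ℤ} (hm : 0 ≤ modulus n h vα vβ) {c s₀ s₁ D : ℤ} (hc : 0 ≤ c)
    (hD : 0 < D) (t₀ c₀ g : V) {K₀ K₁ : ℤ}
    (h0 : |coarseSkel φ t₀ A n h vα vβ c s₀ s₁ D g 0 - coarseSkel φ t₀ A n h vα vβ c s₀ s₁ D c₀ 0| ≤ K₀)
    (h1 : |coarseSkel φ t₀ A n h vα vβ c s₀ s₁ D g 1 - coarseSkel φ t₀ A n h vα vβ c s₀ s₁ D c₀ 1| ≤ K₁) :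
    c * A * modulus n h vα vβ * |relCoord φ c₀ 0 g| ≤ D * ((n : ℤ) * (K₀ + 1) + |vα| * (K₁ + 1)) ∧
      c * A * |shearCoord φ c₀ n h g| ≤ D * (K₁ + 1) := by
  have hcs0 : ∀ w : V, coarseSkel φ t₀ A n h vα vβ c s₀ s₁ D w 0 = coarse c s₀ D (lam0 A vα vβ (relφ φ t₀ w)) := fun w => rfl
  have hcs1 : ∀ w : V, coarseSkel φ t₀ A n h vα vβ c s₀ s₁ D w 1 = coarse c s₁ D (lam1 A n h (relφ φ t₀ w)) := fun w => rfl
  rw [hcs0, hcs0] at h0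
  rw [hcs1, hcs1] at h1
  have e0 := abs_mul_sub_le_of_coarse hD h0
  have e1 := abs_mul_sub_le_of_coarse hD h1
  rw [← mul_sub] at e0 e1
  have hK0 : 0 ≤ K₀ := (abs_nonneg _).trans h0
  have hK1 : 0 ≤ K₁ := (abs_nonneg _).trans h1
  constructor
  · -- `cAm Δα = n cΔλ₀ + vα cΔλ₁`
    have e := A_mul_modulus_mul_relCoord_eq (φ := φ) A n h vα vβ t₀ c₀ g
    set X₀ := c * (lam0 A vα vβ (relφ φ t₀ g) - lam0 A vα vβ (relφ φ t₀ c₀)) with hX₀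
    set X₁ := c * (lam1 A n h (relφ φ t₀ g) - lam1 A n h (relφ φ t₀ c₀)) with hX₁
    have key : c * A * modulus n h vα vβ * relCoord φ c₀ 0 g = (n : ℤ) * X₀ + vα * X₁ := by
      rw [hX₀, hX₁]; linear_combination c * e
    have hpos : 0 ≤ c * A * modulus n h vα vβ := by positivity
    calc c * A * modulus n h vα vβ * |relCoord φ c₀ 0 g| = |c * A * modulus n h vα vβ| * |relCoord φ c₀ 0 g| := by rw [abs_of_nonneg hpos]
      _ = |c * A * modulus n h vα vβ * relCoord φ c₀ 0 g| := (abs_mul _ _).symm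
      _ = |(n : ℤ) * X₀ + vα * X₁| := by rw [key]
      _ ≤ |(n : ℤ) * X₀| + |vα * X₁| := abs_add_le _ _
      _ = (n : ℤ) * |X₀| + |vα| * |X₁| := by rw [abs_mul (n : ℤ) X₀, abs_mul vα X₁, Nat.abs_cast]
      _ ≤ (n : ℤ) * (D * (K₀ + 1) - 1) + |vα| * (D * (K₁ + 1) - 1) :=
        add_le_add (mul_le_mul_of_nonneg_left e0 (Int.natCast_nonneg n)) (mul_le_mul_of_nonneg_left e1 (abs_nonneg _))
      _ ≤ D * ((n : ℤ) * (K₀ + 1) + |vα| * (K₁ + 1)) := by nlinarith [abs_nonneg vα, Int.natCast_nonneg n]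
  · rw [lam1_sub_origin] at e1
    calc c * A * |shearCoord φ c₀ n h g| = |c * (A * shearCoord φ c₀ n h g)| := by
          rw [abs_mul, abs_mul, abs_of_nonneg hc, abs_of_nonneg hA]; ring
      _ ≤ D * (K₁ + 1) - 1 := e1
      _ ≤ D * (K₁ + 1) := by linarith

/-- **Run coordinates from coarse coordinates**: under `D(n(K₀+1) + |vα|(K₁+1)) ≤ c·A·m·a` and `D(K₁+1) ≤ c·A·B` (`0 < c`, `0 < A`, `0 < m`), the coarse
bounds `|Δρ₀| ≤ K₀`, `|Δρ₁| ≤ K₁` give `|Δα| ≤ a` and `|Δβ′| ≤ B`. [cite: MartineauTassion2017, §4.1] -/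
theorem relCoord_shearCoord_le_of_coarse {A : ℤ} (hA : 0 < A) {n : ℕ} {h vα vβ : ℤ} (hm : 0 < modulus n h vα vβ) {c s₀ s₁ D : ℤ} (hc : 0 < c)
    (hD : 0 < D) (t₀ c₀ g : V) {K₀ K₁ a B : ℤ}
    (h0 : |coarseSkel φ t₀ A n h vα vβ c s₀ s₁ D g 0 - coarseSkel φ t₀ A n h vα vβ c s₀ s₁ D c₀ 0| ≤ K₀)
    (h1 : |coarseSkel φ t₀ A n h vα vβ c s₀ s₁ D g 1 - coarseSkel φ t₀ A n h vα vβ c s₀ s₁ D c₀ 1| ≤ K₁)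
    (ha : D * ((n : ℤ) * (K₀ + 1) + |vα| * (K₁ + 1)) ≤ c * A * modulus n h vα vβ * a) (hB : D * (K₁ + 1) ≤ c * A * B) :
    |relCoord φ c₀ 0 g| ≤ a ∧ |shearCoord φ c₀ n h g| ≤ B := by
  obtain ⟨e0, e1⟩ := run_bounds_of_coarse_bounds hA.le hm.le hc.le hD t₀ c₀ g h0 h1
  have hp0 : 0 < c * A * modulus n h vα vβ := by positivity
  have hp1 : 0 < c * A := by positivity
  exact ⟨le_of_mul_le_mul_left (e0.trans ha) hp0, le_of_mul_le_mul_left (e1.trans hB) hp1⟩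

/-- **The run-frame box of a coarse box**: with `a`, `B` as in `relCoord_shearCoord_le_of_coarse` and `B/(n+|h|) + 1 ≤ b`, a vertex with `|Δρ₀| ≤ K₀`,
`|Δρ₁| ≤ K₁` about `c₀` has `runX φ c₀ n h σ g ∈ Icc (−(a,b)) (a,b)` (`σ = ±1`, `1 ≤ n`). [cite: MartineauTassion2017, §4.1] -/
theorem runX_mem_Icc_of_coarse {A : ℤ} (hA : 0 < A) {n : ℕ} (hn : 1 ≤ n) {h vα vβ : ℤ} (hm : 0 < modulus n h vα vβ) {c s₀ s₁ D : ℤ} (hc : 0 < c)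
    (hD : 0 < D) (t₀ c₀ g : V) {σ : ℤ} (hσ : σ = 1 ∨ σ = -1) {K₀ K₁ a B b : ℤ}
    (h0 : |coarseSkel φ t₀ A n h vα vβ c s₀ s₁ D g 0 - coarseSkel φ t₀ A n h vα vβ c s₀ s₁ D c₀ 0| ≤ K₀)
    (h1 : |coarseSkel φ t₀ A n h vα vβ c s₀ s₁ D g 1 - coarseSkel φ t₀ A n h vα vβ c s₀ s₁ D c₀ 1| ≤ K₁)
    (ha : D * ((n : ℤ) * (K₀ + 1) + |vα| * (K₁ + 1)) ≤ c * A * modulus n h vα vβ * a) (hB : D * (K₁ + 1) ≤ c * A * B)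
    (hb : B / (shearUnit n h : ℤ) + 1 ≤ b) :
    runX φ c₀ n h σ g ∈ Finset.Icc (-(![a, b] : Site 2)) ![a, b] := by
  obtain ⟨hα, hβ⟩ := relCoord_shearCoord_le_of_coarse hA hm hc hD t₀ c₀ g h0 h1 ha hB
  have hsu : (0 : ℤ) < shearUnit n h := shearUnit_pos hn h
  have hσabs : |σ| = 1 := by rcases hσ with rfl | rfl <;> norm_num
  have hσα : |σ * relCoord φ c₀ 0 g| ≤ a := by rw [abs_mul, hσabs, one_mul]; exact hα
  have hσβ : |σ * shearCoord φ c₀ n h g| ≤ B := by rw [abs_mul, hσabs, one_mul]; exact hβ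
  have hdiv : |σ * shearCoord φ c₀ n h g / (shearUnit n h : ℤ)| ≤ b := (abs_ediv_le_of_abs_le hsu hσβ).trans hb
  rw [abs_le] at hσα hdiv
  rw [Finset.mem_Icc, Pi.le_def, Pi.le_def, Fin.forall_fin_two, Fin.forall_fin_two]
  simp only [Pi.neg_apply, runX_zero, runX_one, Matrix.cons_val_zero, Matrix.cons_val_one]
  exact ⟨⟨hσα.1, hdiv.1⟩, hσα.2, hdiv.2⟩

/-! ## §3 The cross link of the two-frame corridor -/

/-- **THE FRAME CHANGE (cross link `hx` of `WinChainData.chain₂`)**: inside a habitat `Ω`, the window over the COARSE box `Icc (ρ(c₀) − (K₀,K₁)) (ρ(c₀) + (K₀,K₁))`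
of the coarse skeleton lies in the window over the RUN box `Icc (−(a,b)) (a,b)` of `runX φ c₀ n h σ`, under the two arithmetic conditions of
`relCoord_shearCoord_le_of_coarse` and `B/(n+|h|) + 1 ≤ b`. [cite: KozmaNitzan2024, §4 Lemma 12 (pp. 23–25)] [cite: MartineauTassion2017, §4.1] -/
theorem winIn_coarse_subset_winIn_runX [DecidableEq V] {A : ℤ} (hA : 0 < A) {n : ℕ} (hn : 1 ≤ n) {h vα vβ : ℤ} (hm : 0 < modulus n h vα vβ)
    {c s₀ s₁ D : ℤ} (hc : 0 < c) (hD : 0 < D) (t₀ c₀ : V) {σ : ℤ} (hσ : σ = 1 ∨ σ = -1) (Ω : Finset V) {K₀ K₁ : ℕ} {a B b : ℤ}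
    (ha : D * ((n : ℤ) * (K₀ + 1) + |vα| * (K₁ + 1)) ≤ c * A * modulus n h vα vβ * a) (hB : D * ((K₁ : ℤ) + 1) ≤ c * A * B)
    (hb : B / (shearUnit n h : ℤ) + 1 ≤ b) :
    WinIn (coarseSkel φ t₀ A n h vα vβ c s₀ s₁ D) Ω
        (Finset.Icc (coarseSkel φ t₀ A n h vα vβ c s₀ s₁ D c₀ - ![(K₀ : ℤ), K₁]) (coarseSkel φ t₀ A n h vα vβ c s₀ s₁ D c₀ + ![(K₀ : ℤ), K₁])) ⊆
      WinIn (runX φ c₀ n h σ) Ω (Finset.Icc (-(![a, b] : Site 2)) ![a, b]) := by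
  intro g hg
  rw [mem_WinIn] at hg ⊢
  obtain ⟨hgΩ, hgρ⟩ := hg
  rw [Finset.mem_Icc, Pi.le_def, Pi.le_def, Fin.forall_fin_two, Fin.forall_fin_two] at hgρ
  simp only [Pi.sub_apply, Pi.add_apply, Matrix.cons_val_zero, Matrix.cons_val_one] at hgρ
  obtain ⟨⟨h0l, h1l⟩, h0u, h1u⟩ := hgρ
  refine ⟨hgΩ, runX_mem_Icc_of_coarse (s₀ := s₀) (s₁ := s₁) hA hn hm hc hD t₀ c₀ g hσ (abs_le.2 ⟨by linarith, by linarith⟩)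
    (abs_le.2 ⟨by linarith, by linarith⟩) ha hB hb⟩

end Skelφ

end Summit.CriticalPhenomena.PercolationContinuityZ3.Theorems.Transplant

end
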